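import Summits.QuantumFields.YangMills.Theorems.UV3BranchExpansionCountingAmortizedStep
import Mathlib.Algebra.Order.BigOperators.Ring.Finset
import HarnessLib

/-!
# `UV3BranchExpansionCountingAmortizedInduction` — the LEVEL INDUCTION of the amortized covering inequality for the branch (Möbius) expansion
# of the guarded averaging (crux `UnitScaleTilt.HistoryTailL`, stmt-QuantumFields-19936 — SUPPLY side, record-independent finite combinatorics)

Cell `ym3-torus` (YM ladder rung R3 = continuum SU(2) Yang–Mills on T³ — a RUNG, NOT d = 4, NOT infinite volume, NOT a mass gap, NOT Clay);
width seat `ym-ust-19936-w2` (gen 17), explicit-unit helper; `--supports stmt-QuantumFields-19936 --as helper`.  THEOREMS ONLY (0 `def`,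
0 `sorry`, default heartbeats).

SETTING (n levels).  Bond types `β 0, …, β n` (finite); per level pair `i < n` the blocking data `R i, line i : β (i+1) → Finset (β i)`,
`ctr i : β (i+1) → β i` with the six hypotheses of `UV3BranchExpansionCountingAmortizedStep`.  A PATTERN is `p : (i : Fin n) → Finset (β (i+1))`
(`p i` = the bonds of level `i+1` whose guard is constrained to fire at step `i`).  HYPOTHESIS-SPECIFIED families: distorted sets `Dist p i`
(`hDist0 : Dist p 0 = ∅`, `hDistS : g ∈ Dist p (i+1) ↔ g ∈ p i ∨ line i g ⊆ Dist p i ∪ R(p i)` — fired ∪ GHOSTS), explored sets `X m A p i`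
from a start set `A` at level `m` (`hXm : X m A p m = A`, `hXS : X m A p i = (line(X m A p (i+1) ∖ p i) ∪ R(p i)) ∩ Dist p i` for `i < m` —
an explored fired bond explores the distorted part of its read set, an explored ghost that of its line, EVERY fired bond of the step its read
set), side-slot readers `N i G` (`hN`).  DISCOVERABLE from `(m, A)`: at every step `i < m`, `p i ⊆ X m A p (i+1) ∪ N i (X(i+1) ∖ p i)`.  WEIGHT
from `(m, A)`: `∏_{i<m} x'^{#(p i ∩ X(i+1))}·(x'/y)^{#(p i ∖ X(i+1))}·y^{#(Side_i(X(i+1) ∖ p i) ∖ Dist p i)}` (explored fired bonds `x'`, recruited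
readers `x'/y`, a penalty `y` per non-distorted side slot of an explored ghost — it is read by SOME fired bond; a recruit refunds one penalty).

* §1 `dist_congr`, `explored_restart`, `explored_congr` (distorted∕explored sets depend only on the levels below; restart at level `m`).
* §2 ★★★ `sum_from_le_pow_of_lt` (v1.1: structural binders on `i < n` only) ∕ `sum_from_le_pow`: for `m ≤ n`, `A ⊆ β m`, the weights of the
  patterns supported below `m`, making `A` distorted and discoverable from `(m, A)`, sum to `≤ D m ^ |A|` whenever `0 ≤ D` and
  `D (i+1) ≥ E_i + D_i(y + D_i)^{L−1}(1 + E_i/y)^{(L−1)ρ₀}`, `E_i = x'(1 + D_i)^{r₀}` — induction on `m` inside the fixed pattern type, the step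
  being `UV3BranchExpansionCountingAmortizedStep.sum_step_le_pow` with lower world = patterns supported below `m`.

HONEST SCOPE.  [folklore] finite combinatorics of a displayed recursion; the capacity conversion `x^{|𝐬|} ≤ weight` and the top binomial are in
the sequel `UV3BranchExpansionCountingAmortized`; the model's letters and «live ⇒ discoverable» are not here.  Nothing of hTop, the χ record,
(O‴χₛ), `HistoryTailL`, R3 is proved; the Yang–Mills mass gap is NOT proved.

References: T. Bałaban, CMP **102** (1985) 255–275 [Balaban1985UV3] ((47), (55)); LEAD note `Cruxes/HistoryTailL/HTopBranchExpansion.md` §5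
(2026-08-30) and the shared-reader FINDING (bus 2026-08-30, w2 g17 ∕ px13 g13 ∕ px17 g9; OWNER FINDING #51).
-/

set_option autoImplicit false

namespace Summit.QuantumFields.YangMills.Theorems.UV3BranchExpansionCountingAmortizedInduction

open Finset Summit.QuantumFields.YangMills.Theorems.UV3BranchExpansionCountingAmortizedLetters
  Summit.QuantumFields.YangMills.Theorems.UV3BranchExpansionCountingAmortizedStep

variable {β : ℕ → Type*} [∀ i, DecidableEq (β i)] {n : ℕ}
variable (R line : (i : ℕ) → β (i + 1) → Finset (β i)) (ctr : (i : ℕ) → β (i + 1) → β i)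
variable (Dist : ((i : Fin n) → Finset (β ((i : ℕ) + 1))) → (i : ℕ) → Finset (β i))
variable (X : (m : ℕ) → Finset (β m) → ((i : Fin n) → Finset (β ((i : ℕ) + 1))) → (i : ℕ) → Finset (β i))

/-! ## §1 Bookkeeping of the hypothesis-specified families: distorted sets and explored sets depend only on the levels below -/

/-- The distorted set at level `i ≤ n` depends only on the fired sets below level `i`. [folklore] -/
theorem dist_congr (hDist0 : ∀ p, Dist p 0 = ∅)
    (hDistS : ∀ p (i : Fin n) (g : β ((i : ℕ) + 1)),
      g ∈ Dist p ((i : ℕ) + 1) ↔ g ∈ p i ∨ line i g ⊆ Dist p i ∪ (p i).biUnion (R i))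
    {p q : (i : Fin n) → Finset (β ((i : ℕ) + 1))} :
    ∀ i, i ≤ n → (∀ j : Fin n, (j : ℕ) < i → p j = q j) → Dist p i = Dist q i := by
  intro i
  induction i with
  | zero => intro _ _; rw [hDist0, hDist0]
  | succ i ih =>
    intro hi hpq
    have hin : i < n := Nat.lt_of_succ_le hi
    have hI := ih hin.le (fun j hj => hpq j (Nat.lt_succ_of_lt hj))
    have hpi : p ⟨i, hin⟩ = q ⟨i, hin⟩ := hpq ⟨i, hin⟩ (Nat.lt_succ_self i)
    ext g
    rw [hDistS p ⟨i, hin⟩ g, hDistS q ⟨i, hin⟩ g, hI, hpi]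

/-- RESTART: exploring from level `m + 1` and then reading the explored sets at levels `≤ m` is the same as exploring from level `m` with start set
the explored set at level `m`. [folklore] -/
theorem explored_restart
    (hXm : ∀ m (A : Finset (β m)) p, X m A p m = A)
    (hXS : ∀ m (A : Finset (β m)) p (i : Fin n), (i : ℕ) < m →
      X m A p i = ((X m A p ((i : ℕ) + 1) \ p i).biUnion (line i) ∪ (p i).biUnion (R i)) ∩ Dist p i)
    {m : ℕ} (hm : m < n) (A : Finset (β (m + 1))) (p : (i : Fin n) → Finset (β ((i : ℕ) + 1))) :
    ∀ i, i ≤ m → X (m + 1) A p i = X m (X (m + 1) A p m) p i := by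
  suffices h : ∀ d i, i + d = m → X (m + 1) A p i = X m (X (m + 1) A p m) p i by
    intro i hi; exact h (m - i) i (by omega)
  intro d
  induction d with
  | zero => intro i hi; rw [Nat.add_zero] at hi; subst hi; rw [hXm]
  | succ d ih =>
    intro i hi
    have him : i < m := by omega
    have hin : i < n := lt_trans him hm
    have h1 := hXS (m + 1) A p ⟨i, hin⟩ (by simp; omega)
    have h2 := hXS m (X (m + 1) A p m) p ⟨i, hin⟩ (by simpa using him)
    simp only [Fin.val_mk] at h1 h2
    rw [h1, h2, ih (i + 1) (by omega)]

/-- The explored sets from a fixed start set at level `m ≤ n` depend only on the fired sets below level `m`. [folklore] -/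
theorem explored_congr (hDist0 : ∀ p, Dist p 0 = ∅)
    (hDistS : ∀ p (i : Fin n) (g : β ((i : ℕ) + 1)),
      g ∈ Dist p ((i : ℕ) + 1) ↔ g ∈ p i ∨ line i g ⊆ Dist p i ∪ (p i).biUnion (R i))
    (hXm : ∀ m (A : Finset (β m)) p, X m A p m = A)
    (hXS : ∀ m (A : Finset (β m)) p (i : Fin n), (i : ℕ) < m →
      X m A p i = ((X m A p ((i : ℕ) + 1) \ p i).biUnion (line i) ∪ (p i).biUnion (R i)) ∩ Dist p i)
    {m : ℕ} (hm : m ≤ n) (A : Finset (β m)) {p q : (i : Fin n) → Finset (β ((i : ℕ) + 1))}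
    (hpq : ∀ j : Fin n, (j : ℕ) < m → p j = q j) :
    ∀ i, i ≤ m → X m A p i = X m A q i := by
  suffices h : ∀ d i, i + d = m → X m A p i = X m A q i by
    intro i hi; exact h (m - i) i (by omega)
  intro d
  induction d with
  | zero => intro i hi; rw [Nat.add_zero] at hi; subst hi; rw [hXm, hXm]
  | succ d ih =>
    intro i hi
    have him : i < m := by omega
    have hin : i < n := lt_of_lt_of_le him hm
    have h1 := hXS m A p ⟨i, hin⟩ (by simpa using him)
    have h2 := hXS m A q ⟨i, hin⟩ (by simpa using him)
    simp only [Fin.val_mk] at h1 h2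
    rw [h1, h2, ih (i + 1) (by omega), hpq ⟨i, hin⟩ him,
      dist_congr R line Dist hDist0 hDistS i (le_trans him.le hm) (fun j hj => hpq j (lt_trans hj him))]


/-! ## §2 The level induction inside one ambient pattern type -/

section Induction

variable [∀ i, Fintype (β i)]
variable (N : (i : ℕ) → Finset (β (i + 1)) → Finset (β (i + 1)))
variable {L r₀ ρ₀ : ℕ}

/-- ★★★ **THE AMORTIZED COVERING INEQUALITY, START-SET FORM** (v1.1: the structural binders `hctr hline hdisj hpriv hR hρ` are asked on the
levels `i < n` only — the dischargeable shape on a finite tower, where no `line i` can satisfy `hline ∧ hdisj` beyond the standing range;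
w5-19936 g19 2026-08-30).  For every level `m ≤ n` and start set `A ⊆ β m`, summing over the patterns SUPPORTED BELOW `m` (`p i = ∅` for
`i ≥ m`) that make `A` distorted and are discoverable from `A` (every fired bond is explored or reads a side slot of an explored ghost) the weight
`∏_{i<m} x'^{#(p i ∩ X(i+1))}·(x'/y)^{#(p i ∖ X(i+1))}·y^{#(Side(X(i+1) ∖ p i) ∖ Dist p i)}` gives at most `D m ^ |A|`, provided `0 ≤ D` and
`D (i+1) ≥ E_i + D_i·(y + D_i)^{L−1}·(1 + E_i/y)^{(L−1)ρ₀}`, `E_i = x'(1 + D_i)^{r₀}` (the MULTIPLIER recursion of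
`UV3BranchExpansionCountingAmortizedStep.sum_step_le_pow`).  Proof: induction on `m`; the step splits a pattern supported below `m+1` as
`(p m, update p m ∅)` and is exactly `sum_step_le_pow` with lower world = patterns supported below `m`, using §1 to identify the lower weight and
discoverability read from level `m+1` with the ones read from level `m`. [folklore] -/
theorem sum_from_le_pow_of_lt
    (hctr : ∀ i, i < n → ∀ g, ctr i g ∈ line i g) (hline : ∀ i, i < n → ∀ g, (line i g).card = L)
    (hdisj : ∀ i, i < n → ∀ g g', g ≠ g' → Disjoint (line i g) (line i g'))
    (hpriv : ∀ i, i < n → ∀ g c, ctr i g ∈ R i c → c = g) (hR : ∀ i, i < n → ∀ c, (R i c).card ≤ r₀)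
    (hρ : ∀ i, i < n → ∀ b : β i, (Finset.univ.filter (fun c => b ∈ R i c)).card ≤ ρ₀)
    (hDist0 : ∀ p, Dist p 0 = ∅)
    (hDistS : ∀ p (i : Fin n) (g : β ((i : ℕ) + 1)),
      g ∈ Dist p ((i : ℕ) + 1) ↔ g ∈ p i ∨ line i g ⊆ Dist p i ∪ (p i).biUnion (R i))
    (hXm : ∀ m (A : Finset (β m)) p, X m A p m = A)
    (hXS : ∀ m (A : Finset (β m)) p (i : Fin n), (i : ℕ) < m →
      X m A p i = ((X m A p ((i : ℕ) + 1) \ p i).biUnion (line i) ∪ (p i).biUnion (R i)) ∩ Dist p i)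
    (hN : ∀ i G c, c ∈ N i G ↔ ∃ g ∈ G, ∃ b ∈ (line i g).erase (ctr i g), b ∈ R i c)
    {x' y : ℝ} (hx : 0 ≤ x') (hy : 0 < y) {D : ℕ → ℝ} (hD : ∀ i, 0 ≤ D i)
    (hstep : ∀ i, i < n →
      x' * (1 + D i) ^ r₀ + D i * (y + D i) ^ (L - 1) * (1 + x' / y * (1 + D i) ^ r₀) ^ ((L - 1) * ρ₀) ≤ D (i + 1)) :
    ∀ m, m ≤ n → ∀ A : Finset (β m),
      ∑ p : ((i : Fin n) → Finset (β ((i : ℕ) + 1))),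
        (if (∀ i : Fin n, m ≤ (i : ℕ) → p i = ∅) ∧ A ⊆ Dist p m ∧
            (∀ i : Fin n, (i : ℕ) < m → p i ⊆ X m A p ((i : ℕ) + 1) ∪ N i (X m A p ((i : ℕ) + 1) \ p i)) then
          ∏ i : Fin n, (if (i : ℕ) < m then
            x' ^ (p i ∩ X m A p ((i : ℕ) + 1)).card * (x' / y) ^ (p i \ X m A p ((i : ℕ) + 1)).card *
              y ^ (((X m A p ((i : ℕ) + 1) \ p i).biUnion (fun g => (line i g).erase (ctr i g))) \ Dist p i).card
            else 1)
        else 0) ≤ D m ^ A.card := by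
  classical
  have hy0 : 0 ≤ y := hy.le
  intro m
  induction m with
  | zero =>
    intro _ A
    by_cases hA : A = ∅
    · subst hA
      rw [Finset.card_empty, pow_zero]
      calc _ ≤ ∑ p : ((i : Fin n) → Finset (β ((i : ℕ) + 1))), (if p = (fun _ => ∅) then (1 : ℝ) else 0) := by
            refine Finset.sum_le_sum (fun p _ => ?_)
            by_cases hp : p = fun _ => ∅
            · rw [if_pos hp]
              split_ifs
              · exact le_of_eq (Finset.prod_eq_one (fun i _ => by rw [if_neg (Nat.not_lt_zero _)]))
              · exact zero_le_one
            · rw [if_neg hp, if_neg]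
              rintro ⟨hsupp, -, -⟩
              exact hp (funext (fun i => hsupp i (Nat.zero_le _)))
        _ = 1 := by rw [Finset.sum_ite_eq']; simp
    · refine le_of_eq_of_le (Finset.sum_eq_zero (fun p _ => ?_)) (pow_nonneg (hD 0) _)
      rw [if_neg]
      rintro ⟨-, hAD, -⟩
      rw [hDist0] at hAD
      exact hA (Finset.subset_empty.mp hAD)
  | succ m ih =>
    intro hm A
    have hmn : m < n := Nat.lt_of_succ_le hm
    obtain ⟨μ, rfl⟩ : ∃ μ : Fin n, (μ : ℕ) = m := ⟨⟨m, hmn⟩, rfl⟩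
    have ih' := ih hmn.le
    have hDμ : 0 ≤ D μ := hD μ
    let Pat := (i : Fin n) → Finset (β ((i : ℕ) + 1))
    let supp : ℕ → Pat → Prop := fun k p => ∀ i : Fin n, k ≤ (i : ℕ) → p i = ∅
    let Dsc : (k : ℕ) → Finset (β k) → Pat → Prop := fun k B p =>
      ∀ i : Fin n, (i : ℕ) < k → p i ⊆ X k B p ((i : ℕ) + 1) ∪ N i (X k B p ((i : ℕ) + 1) \ p i)
    let fac : (k : ℕ) → Finset (β k) → Pat → Fin n → ℝ := fun k B p i =>
      x' ^ (p i ∩ X k B p ((i : ℕ) + 1)).card * (x' / y) ^ (p i \ X k B p ((i : ℕ) + 1)).card *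
        y ^ (((X k B p ((i : ℕ) + 1) \ p i).biUnion (fun g => (line i g).erase (ctr i g))) \ Dist p i).card
    let Wt : (k : ℕ) → Finset (β k) → Pat → ℝ := fun k B p =>
      ∏ i : Fin n, (if (i : ℕ) < k then fac k B p i else 1)
    have hfac0 : ∀ k B p i, 0 ≤ fac k B p i := fun k B p i =>
      mul_nonneg (mul_nonneg (pow_nonneg hx _) (pow_nonneg (div_nonneg hx hy0) _)) (pow_nonneg hy0 _)
    have hWt0 : ∀ k B p, 0 ≤ Wt k B p := fun k B p =>
      Finset.prod_nonneg (fun i _ => by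
        by_cases h : (i : ℕ) < k
        · rw [if_pos h]; exact hfac0 k B p i
        · rw [if_neg h]; exact zero_le_one)
    have hupd_ne : ∀ (p : Pat) (s : Finset (β ((μ : ℕ) + 1))) (j : Fin n), (j : ℕ) ≠ (μ : ℕ) →
        Function.update p μ s j = p j := by
      intro p s j hj
      exact Function.update_of_ne (fun h => hj (congrArg Fin.val h)) s p
    have hdist_upd : ∀ (p : Pat) (s : Finset (β ((μ : ℕ) + 1))) i, i ≤ (μ : ℕ) →
        Dist (Function.update p μ s) i = Dist p i := by
      intro p s i hi
      exact dist_congr R line Dist hDist0 hDistS i (le_trans hi hmn.le)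
        (fun j hj => hupd_ne p s j (Nat.ne_of_lt (lt_of_lt_of_le hj hi)))
    have hDistUp : ∀ (p : Pat) (s : Finset (β ((μ : ℕ) + 1))) (g : β ((μ : ℕ) + 1)),
        g ∈ Dist (Function.update p μ s) ((μ : ℕ) + 1) ↔
          g ∈ s ∨ line μ g ⊆ Dist p μ ∪ s.biUnion (R μ) := by
      intro p s g
      rw [hDistS (Function.update p μ s) μ g, Function.update_self, hdist_upd p s μ le_rfl]
    have hXp : ∀ (p : Pat) (s A : Finset (β ((μ : ℕ) + 1))),
        X ((μ : ℕ) + 1) A (Function.update p μ s) μ =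
          ((A \ s).biUnion (line μ) ∪ s.biUnion (R μ)) ∩ Dist p μ := by
      intro p s A
      rw [hXS ((μ : ℕ) + 1) A (Function.update p μ s) μ (Nat.lt_succ_self _), hXm, Function.update_self,
        hdist_upd p s μ le_rfl]
    have hW : ∀ X' : Finset (β μ),
        ∑ p ∈ Finset.univ.filter (fun p : Pat => X' ⊆ Dist p μ ∧ Dsc μ X' p),
          (if supp μ p then Wt μ X' p else 0) ≤ D μ ^ X'.card := by
      intro X'
      rw [Finset.sum_filter]
      refine le_of_eq_of_le (Finset.sum_congr rfl (fun p _ => ?_)) (ih' X')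
      by_cases h1 : X' ⊆ Dist p μ ∧ Dsc μ X' p
      · by_cases h2 : supp μ p
        · rw [if_pos h1, if_pos h2, if_pos ⟨h2, h1.1, h1.2⟩]
        · rw [if_pos h1, if_neg h2, if_neg (fun h => h2 h.1)]
      · rw [if_neg h1, if_neg (fun h => h1 ⟨h.2.1, h.2.2⟩)]
    have hwnn : ∀ (X' : Finset (β μ)) (p : Pat), 0 ≤ (if supp μ p then Wt μ X' p else 0) := by
      intro X' p
      by_cases h : supp μ p
      · rw [if_pos h]; exact hWt0 _ _ _
      · rw [if_neg h]
    have key := sum_step_le_pow (R μ) (line μ) (ctr μ)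
      (fun (X' : Finset (β μ)) (p : Pat) => if supp μ p then Wt μ X' p else 0)
      (fun p : Pat => Dist p μ) (fun (X' : Finset (β μ)) (p : Pat) => Dsc μ X' p)
      (fun (p : Pat) (s : Finset (β ((μ : ℕ) + 1))) => Dist (Function.update p μ s) ((μ : ℕ) + 1))
      (fun (p : Pat) (s A : Finset (β ((μ : ℕ) + 1))) => X ((μ : ℕ) + 1) A (Function.update p μ s) μ) (N μ)
      hwnn (hctr μ μ.isLt) (hline μ μ.isLt) (hdisj μ μ.isLt) (hpriv μ μ.isLt) (hR μ μ.isLt) (hρ μ μ.isLt)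
      hDistUp hXp (hN μ) hx hy hDμ hW A
    have hexp0 : 0 ≤ x' * (1 + D μ) ^ r₀ +
        D μ * (y + D μ) ^ (L - 1) * (1 + x' / y * (1 + D μ) ^ r₀) ^ ((L - 1) * ρ₀) := by positivity
    refine le_trans ?_ (key.trans (pow_le_pow_left₀ hexp0 (hstep μ hmn) _))
    let φ : Pat → Finset (β ((μ : ℕ) + 1)) × Pat := fun q => (q μ, Function.update q μ ∅)
    let gfun : Finset (β ((μ : ℕ) + 1)) × Pat → ℝ := fun z =>
      if A ⊆ Dist (Function.update z.2 μ z.1) ((μ : ℕ) + 1) ∧ z.1 ⊆ A ∪ N μ (A \ z.1) ∧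
          Dsc μ (X ((μ : ℕ) + 1) A (Function.update z.2 μ z.1) μ) z.2 then
        (if supp μ z.2 then Wt μ (X ((μ : ℕ) + 1) A (Function.update z.2 μ z.1) μ) z.2 else 0) *
          x' ^ (z.1 ∩ A).card * (x' / y) ^ (z.1 \ A).card *
          y ^ (((A \ z.1).biUnion (fun g => (line μ g).erase (ctr μ g))) \ Dist z.2 μ).card
      else 0
    have hgfun0 : ∀ z, 0 ≤ gfun z := by
      intro z
      by_cases h : A ⊆ Dist (Function.update z.2 μ z.1) ((μ : ℕ) + 1) ∧ z.1 ⊆ A ∪ N μ (A \ z.1) ∧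
          Dsc μ (X ((μ : ℕ) + 1) A (Function.update z.2 μ z.1) μ) z.2
      · show (0 : ℝ) ≤ (if _ then _ else _)
        rw [if_pos h]
        exact mul_nonneg (mul_nonneg (mul_nonneg (hwnn _ _) (pow_nonneg hx _))
          (pow_nonneg (div_nonneg hx hy0) _)) (pow_nonneg hy0 _)
      · show (0 : ℝ) ≤ (if _ then _ else _)
        rw [if_neg h]
    have hrecon : ∀ q : Pat, Function.update (Function.update q μ ∅) μ (q μ) = q := fun q => by
      rw [Function.update_idem, Function.update_eq_self]
    -- the heart: on a pattern supported below `μ+1`, distorted at `A` and discoverable from `A`,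
    -- the weight read from level `μ+1` equals `gfun (φ q)`
    have heart : ∀ q : Pat, supp ((μ : ℕ) + 1) q → A ⊆ Dist q ((μ : ℕ) + 1) → Dsc ((μ : ℕ) + 1) A q →
        Wt ((μ : ℕ) + 1) A q = gfun (φ q) := by
      intro q hsupp hAq hDq
      show Wt ((μ : ℕ) + 1) A q =
        (if A ⊆ Dist (Function.update (Function.update q μ ∅) μ (q μ)) ((μ : ℕ) + 1) ∧
            q μ ⊆ A ∪ N μ (A \ q μ) ∧
            Dsc μ (X ((μ : ℕ) + 1) A (Function.update (Function.update q μ ∅) μ (q μ)) μ)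
              (Function.update q μ ∅) then
          (if supp μ (Function.update q μ ∅) then
              Wt μ (X ((μ : ℕ) + 1) A (Function.update (Function.update q μ ∅) μ (q μ)) μ)
                (Function.update q μ ∅) else 0) *
            x' ^ (q μ ∩ A).card * (x' / y) ^ (q μ \ A).card *
            y ^ (((A \ q μ).biUnion (fun g => (line μ g).erase (ctr μ g))) \
              Dist (Function.update q μ ∅) μ).card
        else 0)
      rw [hrecon q]
      have hpq : ∀ j : Fin n, (j : ℕ) ≠ (μ : ℕ) → Function.update q μ ∅ j = q j :=
        fun j hj => hupd_ne q ∅ j hj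
      have hsupp' : supp μ (Function.update q μ ∅) := by
        intro i hi
        rcases Nat.eq_or_lt_of_le hi with h | h
        · have : i = μ := Fin.ext h.symm
          rw [this, Function.update_self]
        · rw [hpq i (Nat.ne_of_gt h)]; exact hsupp i h
      have hDlow : ∀ i, i ≤ (μ : ℕ) → Dist q i = Dist (Function.update q μ ∅) i :=
        fun i hi => (hdist_upd q ∅ i hi).symm
      have hXlow : ∀ i, i ≤ (μ : ℕ) →
          X ((μ : ℕ) + 1) A q i = X μ (X ((μ : ℕ) + 1) A q μ) (Function.update q μ ∅) i := by
        intro i hi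
        rw [explored_restart R line Dist X hXm hXS hmn A q i hi]
        exact explored_congr R line Dist X hDist0 hDistS hXm hXS hmn.le _
          (fun j hj => (hpq j (Nat.ne_of_lt hj)).symm) i hi
      have hc2 : q μ ⊆ A ∪ N μ (A \ q μ) := by
        have h := hDq μ (Nat.lt_succ_self _)
        rw [hXm] at h
        exact h
      have hc3 : Dsc μ (X ((μ : ℕ) + 1) A q μ) (Function.update q μ ∅) := by
        intro i hi
        have h := hDq i (Nat.lt_succ_of_lt hi)
        rw [hXlow _ (Nat.succ_le_of_lt hi), ← hpq i (Nat.ne_of_lt hi)] at h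
        exact h
      rw [if_pos ⟨hAq, hc2, hc3⟩, if_pos hsupp']
      have hfac_low : ∀ i : Fin n, (i : ℕ) < (μ : ℕ) →
          fac ((μ : ℕ) + 1) A q i = fac μ (X ((μ : ℕ) + 1) A q μ) (Function.update q μ ∅) i := by
        intro i hi
        show x' ^ (q i ∩ X ((μ : ℕ) + 1) A q ((i : ℕ) + 1)).card *
            (x' / y) ^ (q i \ X ((μ : ℕ) + 1) A q ((i : ℕ) + 1)).card *
            y ^ (((X ((μ : ℕ) + 1) A q ((i : ℕ) + 1) \ q i).biUnion
              (fun g => (line i g).erase (ctr i g))) \ Dist q i).card = _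
        rw [hXlow _ (Nat.succ_le_of_lt hi), ← hpq i (Nat.ne_of_lt hi), hDlow i hi.le]
      have hWt : Wt ((μ : ℕ) + 1) A q =
          fac ((μ : ℕ) + 1) A q μ * Wt μ (X ((μ : ℕ) + 1) A q μ) (Function.update q μ ∅) := by
        show (∏ i : Fin n, (if (i : ℕ) < (μ : ℕ) + 1 then fac ((μ : ℕ) + 1) A q i else 1)) =
          fac ((μ : ℕ) + 1) A q μ *
            ∏ i : Fin n, (if (i : ℕ) < (μ : ℕ) then
              fac μ (X ((μ : ℕ) + 1) A q μ) (Function.update q μ ∅) i else 1)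
        rw [← Finset.mul_prod_erase Finset.univ _ (Finset.mem_univ μ),
          ← Finset.mul_prod_erase Finset.univ
            (fun i : Fin n => if (i : ℕ) < (μ : ℕ) then
              fac μ (X ((μ : ℕ) + 1) A q μ) (Function.update q μ ∅) i else 1) (Finset.mem_univ μ),
          if_pos (Nat.lt_succ_self _), if_neg (lt_irrefl _), one_mul]
        congr 1
        refine Finset.prod_congr rfl (fun i hi => ?_)
        have hne : (i : ℕ) ≠ (μ : ℕ) := fun h => (Finset.ne_of_mem_erase hi) (Fin.ext h)
        by_cases him : (i : ℕ) < (μ : ℕ)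
        · rw [if_pos (Nat.lt_succ_of_lt him), if_pos him, hfac_low i him]
        · have : ¬ (i : ℕ) < (μ : ℕ) + 1 := fun h => him (lt_of_le_of_ne (Nat.le_of_lt_succ h) hne)
          rw [if_neg this, if_neg him]
      rw [hWt]
      show x' ^ (q μ ∩ X ((μ : ℕ) + 1) A q ((μ : ℕ) + 1)).card *
            (x' / y) ^ (q μ \ X ((μ : ℕ) + 1) A q ((μ : ℕ) + 1)).card *
            y ^ (((X ((μ : ℕ) + 1) A q ((μ : ℕ) + 1) \ q μ).biUnion
              (fun g => (line μ g).erase (ctr μ g))) \ Dist q μ).card *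
          Wt μ (X ((μ : ℕ) + 1) A q μ) (Function.update q μ ∅) = _
      rw [hXm, hDlow μ le_rfl]
      ring
    have hinj : Set.InjOn φ (Finset.univ : Finset Pat) := by
      intro q₁ _ q₂ _ h
      have h1 : q₁ μ = q₂ μ := congrArg Prod.fst h
      have h2 : Function.update q₁ μ ∅ = Function.update q₂ μ ∅ := congrArg Prod.snd h
      rw [← hrecon q₁, ← hrecon q₂, h1, h2]
    calc ∑ q : Pat, (if supp ((μ : ℕ) + 1) q ∧ A ⊆ Dist q ((μ : ℕ) + 1) ∧ Dsc ((μ : ℕ) + 1) A q then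
            Wt ((μ : ℕ) + 1) A q else 0)
        ≤ ∑ q : Pat, gfun (φ q) := by
          refine Finset.sum_le_sum (fun q _ => ?_)
          by_cases hc : supp ((μ : ℕ) + 1) q ∧ A ⊆ Dist q ((μ : ℕ) + 1) ∧ Dsc ((μ : ℕ) + 1) A q
          · rw [if_pos hc, heart q hc.1 hc.2.1 hc.2.2]
          · rw [if_neg hc]; exact hgfun0 _
      _ = ∑ z ∈ (Finset.univ : Finset Pat).image φ, gfun z := (Finset.sum_image hinj).symm
      _ ≤ ∑ z ∈ (Finset.univ : Finset (Finset (β ((μ : ℕ) + 1)))) ×ˢ (Finset.univ : Finset Pat), gfun z :=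
          Finset.sum_le_sum_of_subset_of_nonneg
            (fun z _ => Finset.mem_product.mpr ⟨Finset.mem_univ _, Finset.mem_univ _⟩)
            (fun z _ _ => hgfun0 z)
      _ = ∑ s : Finset (β ((μ : ℕ) + 1)), ∑ p : Pat, gfun (s, p) := Finset.sum_product _ _ _
      _ = _ := by rfl

/-- v1.0 statement of `sum_from_le_pow_of_lt` (structural binders for every `i : ℕ`), kept as its corollary. [folklore] -/
theorem sum_from_le_pow
    (hctr : ∀ i g, ctr i g ∈ line i g) (hline : ∀ i g, (line i g).card = L)
    (hdisj : ∀ i g g', g ≠ g' → Disjoint (line i g) (line i g'))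
    (hpriv : ∀ i g c, ctr i g ∈ R i c → c = g) (hR : ∀ i c, (R i c).card ≤ r₀)
    (hρ : ∀ i (b : β i), (Finset.univ.filter (fun c => b ∈ R i c)).card ≤ ρ₀)
    (hDist0 : ∀ p, Dist p 0 = ∅)
    (hDistS : ∀ p (i : Fin n) (g : β ((i : ℕ) + 1)),
      g ∈ Dist p ((i : ℕ) + 1) ↔ g ∈ p i ∨ line i g ⊆ Dist p i ∪ (p i).biUnion (R i))
    (hXm : ∀ m (A : Finset (β m)) p, X m A p m = A)
    (hXS : ∀ m (A : Finset (β m)) p (i : Fin n), (i : ℕ) < m →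
      X m A p i = ((X m A p ((i : ℕ) + 1) \ p i).biUnion (line i) ∪ (p i).biUnion (R i)) ∩ Dist p i)
    (hN : ∀ i G c, c ∈ N i G ↔ ∃ g ∈ G, ∃ b ∈ (line i g).erase (ctr i g), b ∈ R i c)
    {x' y : ℝ} (hx : 0 ≤ x') (hy : 0 < y) {D : ℕ → ℝ} (hD : ∀ i, 0 ≤ D i)
    (hstep : ∀ i, i < n →
      x' * (1 + D i) ^ r₀ + D i * (y + D i) ^ (L - 1) * (1 + x' / y * (1 + D i) ^ r₀) ^ ((L - 1) * ρ₀) ≤ D (i + 1)) :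
    ∀ m, m ≤ n → ∀ A : Finset (β m),
      ∑ p : ((i : Fin n) → Finset (β ((i : ℕ) + 1))),
        (if (∀ i : Fin n, m ≤ (i : ℕ) → p i = ∅) ∧ A ⊆ Dist p m ∧
            (∀ i : Fin n, (i : ℕ) < m → p i ⊆ X m A p ((i : ℕ) + 1) ∪ N i (X m A p ((i : ℕ) + 1) \ p i)) then
          ∏ i : Fin n, (if (i : ℕ) < m then
            x' ^ (p i ∩ X m A p ((i : ℕ) + 1)).card * (x' / y) ^ (p i \ X m A p ((i : ℕ) + 1)).card *
              y ^ (((X m A p ((i : ℕ) + 1) \ p i).biUnion (fun g => (line i g).erase (ctr i g))) \ Dist p i).card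
            else 1)
        else 0) ≤ D m ^ A.card :=
  sum_from_le_pow_of_lt R line ctr Dist X N (fun i _ => hctr i) (fun i _ => hline i) (fun i _ => hdisj i)
    (fun i _ => hpriv i) (fun i _ => hR i) (fun i _ => hρ i) hDist0 hDistS hXm hXS hN hx hy hD hstep

end Induction

end Summit.QuantumFields.YangMills.Theorems.UV3BranchExpansionCountingAmortizedInduction
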